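/-
Copyright: the b2b-balaban cell (near-miss cell 7), T⁴-continuum fan-out; row NE7b ROUND-2 swarm, seat
t4-ne7b-formalise-leaf-02 (gen 3) — sub-row S6g′(a)-TOTAL, file 2∕2 (leaf-10 g2's specification, journal l.8499 (3);
leaf-04 g2's offer l.8981; claim l.9221).  Released under the licence of the surrounding project.
-/
import Summits.QuantumFields.BalabanUV.T4Continuum.Support.HistoryZoneMassLaw
import Summits.QuantumFields.BalabanUV.T4Continuum.Support.HistoryZoneMassJoins

/-!
# Zone mass, the TOTAL: the class-linear sum of the decayed formation mass over the joins (row S6g′(a)-TOTAL, file 2∕2)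

Summits-side support leaf of the T⁴-continuum cell (rung (B)+1 on a FINITE torus only; NOT infinite volume, NOT the
mass gap, NOT the Clay statement; NOT a proof of the spine estimate NE7b).  Row NE7b, route «COUNT», row S6g′
«MASS-BASED SIBLING COUNT» (R-OWNER-22-12 (2)): the budget `Σ_H S_H ≤ Ztot` consumed by leaf-10 g3's
`HistorySiblingEntropy.joins_cost_le_of_budget` (binder `hZtot`) and by the binding's per-join count (leaf-05 g2,
`HistoryJoinsAdm` ∕ `HistoryJoinsCount`), in the currency of leaf-04 g2's cardinality law
`HistoryZoneMassLaw.card_zone_le` (`#zone t X ≤ zmass sh θ WB WM t X + 2A`) and over leaf-05 g2's joins (path-free views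
`HistoryZoneMassJoins.joins` ∕ `tparts` of `HistoryJoins.croots` ∕ `jparts`).  [folklore] structural recursion over the
lineage's carrier `Gen ε` + linear real arithmetic; nothing is quoted from print, nothing printed is asserted, no
`[cite:]` tag, no `Prop`-valued fact of Bałaban's minted; every constant symbolic (trigger c2∕c6).

THE TOTAL.  For a tagged genealogy `G` (shapes `sh`, steps `st = PEv.step ∘ sh`), chronological (`ZoneSkeleton.Chrono st G`),
DATED (`HistoryZoneMassJoins.Dated st true T G` — file 1), and a decay `0 ≤ θ < 1`:
* `sum_joins_zmass_le`: `Σ_{X ∈ joins st G} zmass sh θ WB WM (ftime st X) X ≤ umass sh WB WM G ∕ (1 − θ)`, with `umass` the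
  UNDECAYED mass (`zmass` at `θ = 1` = `WB·Σ_births(fat+1) + WM·nmerges`, `umass_eq_bsum` — CLASS-LINEAR; `nmerges + 1 =
  nbirths`);
* `sum_joins_tparts_zmass_le`: the parts form `Σ_{X ∈ joins} Σ_{P ∈ tparts st X} zmass … (ftime st X) P ≤ umass G ∕ (1 − θ)`
  (the parts of a join carry at most the join's own mass at its step, `sum_tparts_zmass_le`);
* `sum_joins_tparts_zmass_add_le`: with the law's additive constant, `Σ_X Σ_{P ∈ tparts X} (zmass … P + γ) ≤ umass G ∕ (1 − θ)
  + 2γ·nmerges G` (part count `Σ_X #tparts X ≤ 2·nmerges G`, file 1);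
* `finset_sum_joins_le`: the `toFinset` form (a sum of nonnegative terms over the distinct joins is below the list sum) —
  the shape of `hZtot` with `Ls := (croots st G).toFinset` after `sum_croots_eq_sum_joins`.
From a LAX dating apply the strict form one step later (`Dated.strict_succ`): `sum_joins_zmass_le_of_lax`.

WHY THE DATING DISPLAY.  The decay makes the total geometric along the chain of joins ABOVE each formation event —
provided those joins sit at pairwise distinct steps.  Under `Chrono` alone two nested joins may share a step through a
RENEWAL (`merge (renew (merge A B e₁) r h) C e₂` with `st e₁ = st e₂`; renewals close clusters), and then the inner parts
are charged twice at the same decay level — on such trees the total is genuinely not class-linear (file 1 §4 shows the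
sandwich).  Histories read off a process never do this: readiness comes at least one step after the last merger and the
renewal event one step later still (B16 p. 386 — CONTEXT, not asserted; on the `ConsistentT` road it is `st m < reach =
h + 1 = st e_renew`, on the LE road it is the encoding's to supply) — hence the display `Dated`, the binding's to discharge.

PROOF.  The invariant `inv`: under `Dated st s t G` and chronology, `(1 − θ)·Σ_{X ∈ jroots st (some t) G} zmass (ftime X) X
+ zmass t G ≤ umass G`, by structural induction — a node of the parent's own cluster adds up; an earlier join `t′ < t` uses
the hypotheses at `t′` and the exact decay scaling `zmass t G = θ^{t−t′}·zmass t′ G ≤ θ·zmass t′ G` (`zmass_add_eq`); a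
renewal uses `Dated true` to identify `jroots none Y` with `jroots (some t) Y`.  §1 undecayed mass, decay scaling, cluster
bookkeeping; §2 the invariant and the ENDs; §3 sanity.

HONEST SCOPE.  Bookkeeping over OUR carrier; the dating is DISPLAYED; `BirthShapeNodup` is NOT retired by this file; NE7b
NOT proved; spine 0∕9.  HONEST DEPENDENCY (cell): continuum YM on T⁴ ⇐ BetaPertH ∧ nine spine estimates (0/9 proved);
BetaPertH ⇐ (D1) ∧ (D4) ∧ CAP+tail; G-an2-4 gates asym, D1 and NE2/3/4.  This file changes none of it.
-/

open Finset
open Literature.MathematicalPhysics.QuantumFieldTheory.Balaban1983to89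
open T4PersistenceDictionary T4PartnerMultiplicity T4BranchingRecordsGas
open Summit.QuantumFields.BalabanUV.T4Continuum.PlacementSkeleton
open Summit.QuantumFields.BalabanUV.T4Continuum.Crowding
open Summit.QuantumFields.BalabanUV.T4Continuum.ZoneSkeleton
open Summit.QuantumFields.BalabanUV.T4Continuum.ZoneTorus
open Summit.QuantumFields.BalabanUV.T4Continuum.HistoryJoins
open Summit.QuantumFields.BalabanUV.T4Continuum.HistoryZoneMassLaw
open Summit.QuantumFields.BalabanUV.T4Continuum.HistoryZoneMassJoins

namespace Summit.QuantumFields.BalabanUV.T4Continuum.HistoryZoneMassTotal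

noncomputable section

variable {ε : Type*}

/-! ## §1 Undecayed mass, decay scaling, cluster bookkeeping -/

section Mass

variable (sh : ε → PEv)

/-- **THE UNDECAYED FORMATION MASS** (`zmass` at `θ = 1`): births weigh `WB·((sh b).fat + 1)`, merge nodes `WM`,
renewals nothing. [folklore] -/
def umass (WB WM : ℝ) : Gen ε → ℝ
  | Gen.born b _ => WB * (((sh b).fat : ℝ) + 1)
  | Gen.renew Y _ _ => umass WB WM Y
  | Gen.merge Y Z _ => umass WB WM Y + umass WB WM Z + WM

variable {sh} {θ WB WM : ℝ}

/-- **THE UNDECAYED MASS IS CLASS-LINEAR**: the multiplicity-correct birth sum of `WB·(fat+1)` (leaf-05 g2's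
`HistoryJoins.bsum`) plus `WM` per merge node. [folklore] -/
theorem umass_eq_bsum (WB WM : ℝ) : ∀ G : Gen ε,
    umass sh WB WM G = bsum (fun b => WB * (((sh b).fat : ℝ) + 1)) G + WM * (nmerges G : ℝ)
  | Gen.born b _ => by simp [umass, bsum]
  | Gen.renew Y _ _ => umass_eq_bsum WB WM Y
  | Gen.merge Y Z _ => by
      simp only [umass, bsum, nmerges_merge, umass_eq_bsum WB WM Y, umass_eq_bsum WB WM Z]
      push_cast; ring

/-- the undecayed mass is nonnegative [folklore] -/
theorem umass_nonneg (hB : 0 ≤ WB) (hM : 0 ≤ WM) : ∀ G : Gen ε, 0 ≤ umass sh WB WM G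
  | Gen.born b _ => by unfold umass; positivity
  | Gen.renew Y _ _ => umass_nonneg hB hM Y
  | Gen.merge Y Z _ => by
      have hY := umass_nonneg hB hM Y
      have hZ := umass_nonneg hB hM Z
      show 0 ≤ umass sh WB WM Y + umass sh WB WM Z + WM
      positivity

/-- the decayed mass is at most the undecayed mass (`0 ≤ θ ≤ 1`) [folklore] -/
theorem zmass_le_umass (hθ0 : 0 ≤ θ) (hθ1 : θ ≤ 1) (hB : 0 ≤ WB) (hM : 0 ≤ WM) (t : ℕ) :
    ∀ G : Gen ε, zmass sh θ WB WM t G ≤ umass sh WB WM G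
  | Gen.born b _ => by
      show WB * (((sh b).fat : ℝ) + 1) * θ ^ (t - (sh b).step) ≤ WB * (((sh b).fat : ℝ) + 1)
      exact mul_le_of_le_one_right (by positivity) (pow_le_one₀ hθ0 hθ1)
  | Gen.renew Y _ _ => zmass_le_umass hθ0 hθ1 hB hM t Y
  | Gen.merge Y Z e => by
      have hY := zmass_le_umass hθ0 hθ1 hB hM t Y
      have hZ := zmass_le_umass hθ0 hθ1 hB hM t Z
      have hW : WM * θ ^ (t - (sh e).step) ≤ WM := mul_le_of_le_one_right hM (pow_le_one₀ hθ0 hθ1)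
      show zmass sh θ WB WM t Y + zmass sh θ WB WM t Z + WM * θ ^ (t - (sh e).step) ≤
        umass sh WB WM Y + umass sh WB WM Z + WM
      linarith

/-- **CLUSTER BOOKKEEPING AT THE CLUSTER STEP**: the parts' masses plus `WM` per dissolved node is the whole mass.
[folklore] -/
theorem sum_cparts_zmass (t : ℕ) : ∀ X : Gen ε,
    ((cparts (PEv.step ∘ sh) t X).map fun P => zmass sh θ WB WM t P).sum + WM * (cnodes (PEv.step ∘ sh) t X : ℝ) =
      zmass sh θ WB WM t X
  | Gen.born b j => by simp
  | Gen.renew Y e h => by simp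
  | Gen.merge Y Z e => by
      by_cases he : (PEv.step ∘ sh) e = t
      · have he' : (sh e).step = t := he
        have hY := sum_cparts_zmass t Y
        have hZ := sum_cparts_zmass t Z
        rw [cparts_merge_of_eq _ he, List.map_append, List.sum_append, cnodes_merge_of_eq _ he]
        show ((cparts (PEv.step ∘ sh) t Y).map fun P => zmass sh θ WB WM t P).sum +
            ((cparts (PEv.step ∘ sh) t Z).map fun P => zmass sh θ WB WM t P).sum +
            WM * ((cnodes (PEv.step ∘ sh) t Y + cnodes (PEv.step ∘ sh) t Z + 1 : ℕ) : ℝ) =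
          zmass sh θ WB WM t Y + zmass sh θ WB WM t Z + WM * θ ^ (t - (sh e).step)
        rw [he', Nat.sub_self, pow_zero]; push_cast; linarith
      · rw [cparts_merge_of_ne _ he, cnodes_merge_of_ne _ he]; simp

/-- **THE PARTS OF A JOIN CARRY AT MOST THE JOIN'S OWN MASS** at the join step. [folklore] -/
theorem sum_tparts_zmass_le (hM : 0 ≤ WM) (Y Z : Gen ε) (e : ε) :
    ((tparts (PEv.step ∘ sh) (Gen.merge Y Z e)).map fun P => zmass sh θ WB WM (sh e).step P).sum ≤
      zmass sh θ WB WM (sh e).step (Gen.merge Y Z e) := by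
  show ((tparts (PEv.step ∘ sh) (Gen.merge Y Z e)).map fun P => zmass sh θ WB WM ((PEv.step ∘ sh) e) P).sum ≤
    zmass sh θ WB WM ((PEv.step ∘ sh) e) (Gen.merge Y Z e)
  have h := sum_cparts_zmass (sh := sh) (θ := θ) (WB := WB) (WM := WM) ((PEv.step ∘ sh) e) (Gen.merge Y Z e)
  have h0 : 0 ≤ WM * (cnodes (PEv.step ∘ sh) ((PEv.step ∘ sh) e) (Gen.merge Y Z e) : ℝ) := by positivity
  rw [tparts_merge, ← cparts_merge_of_eq (PEv.step ∘ sh) rfl]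
  linarith

end Mass

/-! ## §2 The invariant and the total -/

section Total

variable [DecidableEq ε] {sh : ε → PEv} {θ WB WM : ℝ}

/-- **EXACT DECAY SCALING**: for a chronological structure formed by `u`, `zmass (u + k) X = θ^k · zmass u X` (all its
formation events are dated `≤ u`, so the truncated ages add up). [folklore] -/
theorem zmass_add_eq (θ WB WM : ℝ) (k : ℕ) {u : ℕ} :
    ∀ {X : Gen ε}, Chrono (PEv.step ∘ sh) X → ftime (PEv.step ∘ sh) X ≤ u →
      zmass sh θ WB WM (u + k) X = θ ^ k * zmass sh θ WB WM u X
  | Gen.born b j, _, hf => by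
      have hf' : (sh b).step ≤ u := hf
      show WB * (((sh b).fat : ℝ) + 1) * θ ^ (u + k - (sh b).step) =
        θ ^ k * (WB * (((sh b).fat : ℝ) + 1) * θ ^ (u - (sh b).step))
      rw [show u + k - (sh b).step = (u - (sh b).step) + k by omega, pow_add]; ring
  | Gen.renew Y _ _, hc, hf => zmass_add_eq θ WB WM k (X := Y) hc hf
  | Gen.merge Y Z e, hc, hf => by
      have hfe : (sh e).step ≤ u := hf
      obtain ⟨hfY, hfZ⟩ := ftime_le_of_chrono (PEv.step ∘ sh) hc
      have hY := zmass_add_eq θ WB WM k hc.1 (hfY.trans hfe)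
      have hZ := zmass_add_eq θ WB WM k hc.2.1 (hfZ.trans hfe)
      show zmass sh θ WB WM (u + k) Y + zmass sh θ WB WM (u + k) Z + WM * θ ^ (u + k - (sh e).step) =
        θ ^ k * (zmass sh θ WB WM u Y + zmass sh θ WB WM u Z + WM * θ ^ (u - (sh e).step))
      rw [hY, hZ, show u + k - (sh e).step = (u - (sh e).step) + k by omega, pow_add]; ring

/-- **THE INVARIANT**: under `Dated s t G` and chronology,
`(1 − θ)·Σ_{X ∈ jroots (some t) G} zmass (ftime X) X + zmass t G ≤ umass G`. [folklore] -/
theorem inv (hθ0 : 0 ≤ θ) (hθ1 : θ ≤ 1) (hB : 0 ≤ WB) (hM : 0 ≤ WM) :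
    ∀ (G : Gen ε) (s : Bool) (t : ℕ), Dated (PEv.step ∘ sh) s t G → Chrono (PEv.step ∘ sh) G →
      (1 - θ) * ((jroots (PEv.step ∘ sh) (some t) G).map
          fun X => zmass sh θ WB WM (ftime (PEv.step ∘ sh) X) X).sum +
        zmass sh θ WB WM t G ≤ umass sh WB WM G
  | Gen.born b j, s, t, _, _ => by
      simpa using zmass_le_umass (sh := sh) hθ0 hθ1 hB hM t (Gen.born b j)
  | Gen.renew Y e h, s, t, hD, hC => by
      rw [dated_renew] at hD
      rw [jroots_renew, jroots_none_eq_some hD]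
      exact inv hθ0 hθ1 hB hM Y true t hD hC
  | Gen.merge A B e, s, t, hD, hC => by
      rw [dated_merge] at hD
      obtain ⟨hle, -, hDA, hDB⟩ := hD
      have ihA := inv hθ0 hθ1 hB hM A false ((PEv.step ∘ sh) e) hDA hC.1
      have ihB := inv hθ0 hθ1 hB hM B false ((PEv.step ∘ sh) e) hDB hC.2.1
      -- the join's own mass at its step splits over the partners
      have hsplit : zmass sh θ WB WM ((PEv.step ∘ sh) e) (Gen.merge A B e) =
          zmass sh θ WB WM ((PEv.step ∘ sh) e) A + zmass sh θ WB WM ((PEv.step ∘ sh) e) B + WM := by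
        show zmass sh θ WB WM (sh e).step A + zmass sh θ WB WM (sh e).step B + WM * θ ^ ((sh e).step - (sh e).step) = _
        rw [Nat.sub_self, pow_zero, mul_one]; rfl
      by_cases he : (PEv.step ∘ sh) e = t
      · -- a node of the parent's own cluster: additivity
        subst he
        rw [jroots_merge_of_eq _ rfl, List.map_append, List.sum_append, hsplit]
        show _ ≤ umass sh WB WM A + umass sh WB WM B + WM
        linarith
      · -- an earlier join `t' < t`: the hypotheses at `t'` and at least one step of decay
        have hlt : (PEv.step ∘ sh) e < t := lt_of_le_of_ne hle he
        rw [jroots_merge_of_ne _ he, joins_merge, List.map_cons, List.sum_cons, List.map_append, List.sum_append]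
        have hft : ftime (PEv.step ∘ sh) (Gen.merge A B e) = (PEv.step ∘ sh) e := rfl
        rw [hft]
        have hsc := zmass_add_eq (sh := sh) θ WB WM (t - (PEv.step ∘ sh) e) (u := (PEv.step ∘ sh) e)
          (X := Gen.merge A B e) hC (le_of_eq hft)
        rw [show (PEv.step ∘ sh) e + (t - (PEv.step ∘ sh) e) = t by omega] at hsc
        have hz0 : 0 ≤ zmass sh θ WB WM ((PEv.step ∘ sh) e) (Gen.merge A B e) := zmass_nonneg hθ0 hB hM _ _
        have hpow : θ ^ (t - (PEv.step ∘ sh) e) ≤ θ := by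
          have h1 : θ ^ (t - (PEv.step ∘ sh) e) ≤ θ ^ 1 := pow_le_pow_of_le_one hθ0 hθ1 (by omega)
          rwa [pow_one] at h1
        have hdec : zmass sh θ WB WM t (Gen.merge A B e) ≤ θ * zmass sh θ WB WM ((PEv.step ∘ sh) e) (Gen.merge A B e) := by
          rw [hsc]; exact mul_le_mul_of_nonneg_right hpow hz0
        have h1θ : 0 ≤ 1 - θ := by linarith
        show (1 - θ) * (zmass sh θ WB WM ((PEv.step ∘ sh) e) (Gen.merge A B e) +
            (((jroots (PEv.step ∘ sh) (some ((PEv.step ∘ sh) e)) A).map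
                fun X => zmass sh θ WB WM (ftime (PEv.step ∘ sh) X) X).sum +
              ((jroots (PEv.step ∘ sh) (some ((PEv.step ∘ sh) e)) B).map
                fun X => zmass sh θ WB WM (ftime (PEv.step ∘ sh) X) X).sum)) +
          zmass sh θ WB WM t (Gen.merge A B e) ≤ umass sh WB WM A + umass sh WB WM B + WM
        nlinarith [hdec, hsplit, ihA, ihB, hz0, h1θ]

/-- **THE TOTAL, LIST FORM**: for a chronological, strictly dated shape tree and `0 ≤ θ < 1`, the decayed masses of the
joins at their steps sum to at most `umass G ∕ (1 − θ)`. [folklore] -/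
theorem sum_joins_zmass_le (hθ0 : 0 ≤ θ) (hθ1 : θ < 1) (hB : 0 ≤ WB) (hM : 0 ≤ WM) {G : Gen ε} {T : ℕ}
    (hD : Dated (PEv.step ∘ sh) true T G) (hC : Chrono (PEv.step ∘ sh) G) :
    ((joins (PEv.step ∘ sh) G).map fun X => zmass sh θ WB WM (ftime (PEv.step ∘ sh) X) X).sum ≤
      umass sh WB WM G / (1 - θ) := by
  have h := inv hθ0 hθ1.le hB hM G true T hD hC
  rw [← jroots_none_eq_some hD, ← joins_eq_jroots] at h
  have hz : 0 ≤ zmass sh θ WB WM T G := zmass_nonneg hθ0 hB hM _ _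
  rw [le_div_iff₀ (by linarith), mul_comm]
  linarith

/-- the same from a LAX dating (the strict form one step later) [folklore] -/
theorem sum_joins_zmass_le_of_lax (hθ0 : 0 ≤ θ) (hθ1 : θ < 1) (hB : 0 ≤ WB) (hM : 0 ≤ WM) {G : Gen ε} {T : ℕ}
    (hD : Dated (PEv.step ∘ sh) false T G) (hC : Chrono (PEv.step ∘ sh) G) :
    ((joins (PEv.step ∘ sh) G).map fun X => zmass sh θ WB WM (ftime (PEv.step ∘ sh) X) X).sum ≤
      umass sh WB WM G / (1 - θ) :=
  sum_joins_zmass_le hθ0 hθ1 hB hM hD.strict_succ hC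

/-- **THE TOTAL, PARTS FORM**: `Σ_{X ∈ joins} Σ_{P ∈ tparts X} zmass (ftime X) P ≤ umass G ∕ (1 − θ)`. [folklore] -/
theorem sum_joins_tparts_zmass_le (hθ0 : 0 ≤ θ) (hθ1 : θ < 1) (hB : 0 ≤ WB) (hM : 0 ≤ WM) {G : Gen ε} {T : ℕ}
    (hD : Dated (PEv.step ∘ sh) true T G) (hC : Chrono (PEv.step ∘ sh) G) :
    ((joins (PEv.step ∘ sh) G).map fun X =>
        ((tparts (PEv.step ∘ sh) X).map fun P => zmass sh θ WB WM (ftime (PEv.step ∘ sh) X) P).sum).sum ≤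
      umass sh WB WM G / (1 - θ) := by
  refine le_trans (sum_map_le_sum_map fun X hX => ?_) (sum_joins_zmass_le hθ0 hθ1 hB hM hD hC)
  obtain ⟨A, B, e, rfl⟩ := exists_eq_merge_of_mem_joins (PEv.step ∘ sh) hX
  exact sum_tparts_zmass_le (sh := sh) (WB := WB) hM A B e

/-- **THE TOTAL WITH THE LAW'S ADDITIVE CONSTANT**: `Σ_X Σ_{P ∈ tparts X} (zmass … P + γ) ≤ umass G ∕ (1 − θ) +
2γ·nmerges G` — the shape in which `HistoryZoneMassLaw.card_zone_le` (`γ = 2A`) prices each part. [folklore] -/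
theorem sum_joins_tparts_zmass_add_le (hθ0 : 0 ≤ θ) (hθ1 : θ < 1) (hB : 0 ≤ WB) (hM : 0 ≤ WM) {γ : ℝ} (hγ : 0 ≤ γ)
    {G : Gen ε} {T : ℕ} (hD : Dated (PEv.step ∘ sh) true T G) (hC : Chrono (PEv.step ∘ sh) G) :
    ((joins (PEv.step ∘ sh) G).map fun X =>
        ((tparts (PEv.step ∘ sh) X).map fun P => zmass sh θ WB WM (ftime (PEv.step ∘ sh) X) P + γ).sum).sum ≤
      umass sh WB WM G / (1 - θ) + 2 * γ * (nmerges G : ℝ) := by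
  have hmain := sum_joins_tparts_zmass_le hθ0 hθ1 hB hM hD hC
  have hcount : (((joins (PEv.step ∘ sh) G).map fun X => (tparts (PEv.step ∘ sh) X).length).sum : ℝ) ≤
      2 * (nmerges G : ℝ) := by exact_mod_cast sum_length_tparts_le (PEv.step ∘ sh) G
  -- split each inner sum into the mass part and `γ·#parts`
  have hsplit : ((joins (PEv.step ∘ sh) G).map fun X =>
        ((tparts (PEv.step ∘ sh) X).map fun P => zmass sh θ WB WM (ftime (PEv.step ∘ sh) X) P + γ).sum).sum =
      ((joins (PEv.step ∘ sh) G).map fun X =>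
        ((tparts (PEv.step ∘ sh) X).map fun P => zmass sh θ WB WM (ftime (PEv.step ∘ sh) X) P).sum).sum +
      γ * (((joins (PEv.step ∘ sh) G).map fun X => (tparts (PEv.step ∘ sh) X).length).sum : ℝ) := by
    have h1 : ∀ X : Gen ε,
        ((tparts (PEv.step ∘ sh) X).map fun P => zmass sh θ WB WM (ftime (PEv.step ∘ sh) X) P + γ).sum =
          ((tparts (PEv.step ∘ sh) X).map fun P => zmass sh θ WB WM (ftime (PEv.step ∘ sh) X) P).sum +
            γ * ((tparts (PEv.step ∘ sh) X).length : ℝ) := by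
      intro X; rw [List.sum_map_add, sum_map_const]; ring
    rw [List.map_congr_left (fun X _ => h1 X), List.sum_map_add, List.sum_map_mul_left, Nat.cast_list_sum,
      List.map_map]
    rfl
  rw [hsplit]
  nlinarith [mul_le_mul_of_nonneg_left hcount hγ]

/-- a sum of nonnegative terms over the DISTINCT members of a list is at most the list sum [folklore] -/
theorem finset_sum_le_list_sum {α : Type*} [DecidableEq α] (l : List α) {F : α → ℝ} (hF : ∀ a ∈ l, 0 ≤ F a) :
    ∑ a ∈ l.toFinset, F a ≤ (l.map F).sum := by
  rw [Finset.sum_list_map_count]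
  refine Finset.sum_le_sum fun a ha => ?_
  have hmem : a ∈ l := List.mem_toFinset.1 ha
  have h1 : (1 : ℝ) ≤ (l.count a : ℕ) := by exact_mod_cast List.count_pos_iff.2 hmem
  rw [nsmul_eq_mul]
  nlinarith [hF a hmem]

/-- **THE TOTAL, FINSET FORM** (the shape of `HistorySiblingEntropy.joins_cost_le_of_budget`'s `hZtot` over the distinct
joins, after `HistoryZoneMassJoins.sum_croots_eq_sum_joins` if written over `croots`). [folklore] -/
theorem finset_sum_joins_le (hθ0 : 0 ≤ θ) (hθ1 : θ < 1) (hB : 0 ≤ WB) (hM : 0 ≤ WM) {γ : ℝ} (hγ : 0 ≤ γ)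
    {G : Gen ε} {T : ℕ} (hD : Dated (PEv.step ∘ sh) true T G) (hC : Chrono (PEv.step ∘ sh) G) :
    ∑ X ∈ (joins (PEv.step ∘ sh) G).toFinset,
        ((tparts (PEv.step ∘ sh) X).map fun P => zmass sh θ WB WM (ftime (PEv.step ∘ sh) X) P + γ).sum ≤
      umass sh WB WM G / (1 - θ) + 2 * γ * (nmerges G : ℝ) := by
  refine le_trans (finset_sum_le_list_sum _ fun X _ => ?_) (sum_joins_tparts_zmass_add_le hθ0 hθ1 hB hM hγ hD hC)
  refine List.sum_nonneg ?_
  intro x hx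
  obtain ⟨P, _, rfl⟩ := List.mem_map.1 hx
  have := zmass_nonneg (sh := sh) hθ0 hB hM (ftime (PEv.step ∘ sh) X) P
  linarith

end Total

/-! ## §3 Sanity (closed instances) -/

namespace Sanity

/-- shapes read by `Prod.fst : PEv × ℕ → PEv`; `((a b)₃ c)₃` (births at steps 0, 1, 2, fatness 0) with `WB = 1`,
`WM = 4`: undecayed mass `3·1 + 2·4 = 11` -/
example :
    umass (Prod.fst : PEv × ℕ → PEv) 1 4
        (Gen.merge (Gen.merge (Gen.born (((0, 0, 0) : PEv), 0) 0) (Gen.born (((1, 0, 0) : PEv), 1) 1)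
          (((3, 2, 0) : PEv), 2)) (Gen.born (((2, 0, 0) : PEv), 3) 2) (((3, 2, 0) : PEv), 4)) = 11 := by
  norm_num [umass, PEv.fat]

/-- the unit of decay bookkeeping: with `θ = 1/2` a mass formed at step 1 and read at step 3 weighs a quarter of its
undecayed value — `zmass` of the single birth `a` (fatness 1, `WB = 1`): `2·(1/2)² = 1/2` -/
example : zmass (Prod.fst : PEv × ℕ → PEv) (1 / 2) 1 4 3 (Gen.born (((1, 0, 1) : PEv), 0) 1) = 1 / 2 := by
  norm_num [zmass, PEv.fat, PEv.step]

end Sanity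

end

end Summit.QuantumFields.BalabanUV.T4Continuum.HistoryZoneMassTotal
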